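import Literature.IUT.HodgeArakelov.GMonoidFrobenioidsGaussian
import Literature.IUT.HodgeArakelov.GMonoidFrobenioidsDef38Proofs
import HarnessLib

/-!
# [IUTchII] Definition 3.8 (ii) — proof companion of `GMonoidFrobenioidsGaussian.lean`: the Gaussian Frobenioid `F_ξ(M^Θ_*)`
# satisfies the hypotheses of [FrdI] Thm 5.2, and its divisor monoid is `ℕ` at EVERY object of `𝓑(G)⁰`

S. Mochizuki, *Inter-universal Teichmüller theory II*, §3, kurims manuscript (Dec. 2020), Definition 3.8 (ii) p. 113 l. 58 –
p. 114 l. 1: «Each of the monoids equipped with a topological group action … `G_v(M^Θ_*▶)_⟨F_l^⋇⟩ ↷ Ψ_ξ(M^Θ_*)`;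
`G_v(M^Θ_*)_⟨F_l^⋇⟩ ↷ Ψ_{F_ξ}(†F_v)` … gives rise to a `p_v`-adic Frobenioid of monoid type `ℤ` [cf. [FrdII], Example 1.1, (ii)]
… whose divisor monoid associates to every object of `B^temp(G_v(−))⁰` … a monoid isomorphic to `ℕ`»
[cite: Mochizuki2012, Def 3.8 (ii) p.113]; Corollary 3.5 (ii) p. 95, Corollary 3.7 (i) p. 111 [cite: Mochizuki2012, Cor 3.7 (i) p.111];
[FrdI] Thm 5.2 hypotheses («`Φ` a divisorial monoid on a connected, totally epimorphic category `D`, `B` a group-like monoid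
on `D`») [cite: MochizukiFrdI2008, Thm 5.2 p.100].  Claim key DISPUTED (D-0012): nothing of [IUTchII] is asserted.

abc-iut cell, layer L6, MERGE-MAP row **R-Def38-a**, item «GAUSSIAN-FRD», seat abc-iut-L6-t7 gen 6.  PROOF-ONLY companion of the
def-bearing `GMonoidFrobenioidsGaussian.lean` (`ofStableMonoid`, `diagonalAct`, `gaussianCovering β ξ hS = G_⟨F_l^⋇⟩ ↷ Ψ_ξ`,
`Fgau β ξ hS = F_ξ(M^Θ_*)`, `gaussianMonoidIso`, `fgauMapOfPairIso`): 0 `def`/`structure`/`instance`, no new `Prop` fact.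
abc-iut-L1-lead's interface condition (2) («`gives rise to a Frobenioid` is honest only if you ALSO discharge
`ModelFrobenioid.Hypotheses Φ B`») for the GAUSSIAN monoid — the twin of abc-iut-w4-d019's `hypotheses_ofStable_splitMonoid`
(`GMonoidFrobenioidsDef38Proofs`, split monoids `U·θ^ℕ` in a commutative GROUP) for `Ψ_ξ = Ψ^×_⟨F_l^⋇⟩·ξ^ℕ` inside the
commutative MONOID `∏_{|t|} Ψ_cns,|t| = (T → M)`; w4-d019's generic `isMonoidOn_invariantsFunctor_of /
isMonoidOn_divisorFunctor_of / isMonoidOn_ratFnFunctor / isGroupLike_ratFnFunctor / isGraphConnected_cosetCat /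
isCancelMul_invariants` and abc-iut-L1's `isPreDivisorial_of_isIntegral_of_isSaturated`, `isSaturated_of_dvd_of_pow_dvd_pow`,
`IsPreDivisorial.isDivisorial_associates` are consumed BY NAME.

WHAT IS PROVED, for a value-profile `ξ` FIXED label by label (`hξ : ∀ g t, β g (ξ t) = ξ t` — Cor 3.5 (ii)'s situation: `ξ_t`
is the restriction of the class `θ` to its own decomposition group `D^δ_{t,μ_-} = G_v(−)_{|t|}`), a CANCELLATIVE constant
monoid `M = Ψ_cns ≅ O^▷_{F̄_v}` (`[IsCancelMul M]`) and `ξ` NOT A UNIT of `∏ Ψ_{|t|}` (`hξu` — «`q̲_v^{j²}`, `j ∈ F_l^⋇`, has positive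
valuation»; the analogue of w4-d019's «`θ` non-torsion modulo `U`»):
* §1 the unit/degree calculus of `Ψ_ξ`: uniqueness of the exponent in `c·ξ^n` (`gaussian_exponent_unique`), the unit part of an
  invariant is invariant (`unitPart_mem_invariants`), invariant unit diagonals are units OF `Ψ_ξ^V` (`isUnit_invariants_of_mem_unitDiagonal`),
  units of `Ψ_ξ^V` have exponent `0` (`exponent_eq_zero_of_isUnit_invariants`), every invariant is `c·ξ^n` with `c` an INVARIANT
  unit diagonal (`exists_unitDiagonal_invariants_mul_pow`);
* §2 `exists_associates_invariants_gaussian_equiv_nat` — **«divisor monoid ≅ ℕ at EVERY object»**: `Associates (Ψ_ξ^V) ≃* ℕ`,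
  `[c·ξ^n] ↦ n`, for every `V ≤ G`;
* §3 `isPreDivisorial_invariants_gaussian`, `isDivisorial_divisorFunctor_gaussian`, `associatesMap_pull_injective_gaussian` (the
  pull-back `Ψ_ξ^{V'} → Ψ_ξ^{U'}`, `x ↦ a·x`, is the IDENTITY of `ℕ` on divisor classes — monoid type `ℤ`, no ramification in the
  `ξ`-direction), `isMonoidOn_invariantsFunctor_gaussian`, `isMonoidOn_divisorFunctor_gaussian`, and
  **`hypotheses_gaussian : ModelFrobenioid.Hypotheses (gaussianCovering β ξ hS).divisorFunctor (gaussianCovering β ξ hS).ratFnFunctor`**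
  — so `Fgau β ξ hS = F_ξ(M^Θ_*)` is an honest instance of abc-iut-L1-t2's [FrdI] Thm 5.2 model Frobenioid; by `FFgau γ e ξ hS' :=
  Fgau γ (e⁻¹∘ξ) hS'` the same theorems apply verbatim to `F_{F_ξ}(†F_v)`.
HONEST LIMITS: hypotheses `hξ` / `[IsCancelMul M]` / `hξu` are the printed situation but are INPUTS here (discharged at the genuine
records by their owners, not in this file); nothing of [FrdI]/[FrdII] is re-typed; no side taken on [IUTchIII] Cor 3.12; typed ≠
proved elsewhere; nothing asserts abc proved or refuted.
-/

namespace Literature.IUT.HodgeArakelov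

namespace BadPrimeGaussianMonoids

open CategoryTheory Opposite Function
open Literature.AlgebraicGeometry.Frobenioids Literature.AnabelianGeometry.SemiGraphs TemperedThetaMonoids CoveringMonoid

universe u v w

/-! ### §1. The unit / exponent calculus of `Ψ_ξ = Ψ^×_⟨F_l^⋇⟩ · ξ^ℕ` -/

section Calculus

variable {T : Type w} {M : Type v} [CommMonoid M] [IsCancelMul M] {G : Type u} [Group G] (β : G →* MulAut M)
  {ξ : T → M} (hξ : ∀ (g : G) (t : T), β g (ξ t) = ξ t) (hξu : ¬ IsUnit ξ)
  (hS : ∀ (g : G) (y : T → M), y ∈ gaussianMonoid ξ → piIso T (β g) y ∈ gaussianMonoid ξ)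

omit [IsCancelMul M] in
include hξu in
/-- A power of a non-unit `ξ` is a unit only for the exponent `0` (private helper). [folklore] -/
private theorem exponent_eq_zero_of_isUnit_pow {n : ℕ} (h : IsUnit (ξ ^ n)) : n = 0 := by
  by_contra hn
  exact hξu ((isUnit_pow_iff hn).mp h)

include hξu in
/-- **Uniqueness of the exponent** in `Ψ_ξ`: `c·ξ^n = c'·ξ^m` with `c`, `c'` unit diagonals forces `n = m` (`M` cancellative,
`ξ` a non-unit) — the monoid shadow of «monoid type `ℤ`». [cite: Mochizuki2012, Cor 3.5 (iii) p.95] -/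
theorem gaussian_exponent_unique {c c' : T → M} (hc : c ∈ unitDiagonal T M) (hc' : c' ∈ unitDiagonal T M) {n m : ℕ}
    (h : c * ξ ^ n = c' * ξ ^ m) : n = m := by
  obtain ⟨u, rfl⟩ := hc
  obtain ⟨u', rfl⟩ := hc'
  have hcu : IsUnit (fun _ : T => (u : M)) := ⟨⟨fun _ => (u : M), fun _ => ((u⁻¹ : Mˣ) : M),
    funext fun _ => u.mul_inv, funext fun _ => u.inv_mul⟩, rfl⟩
  have hcu' : IsUnit (fun _ : T => (u' : M)) := ⟨⟨fun _ => (u' : M), fun _ => ((u'⁻¹ : Mˣ) : M),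
    funext fun _ => u'.mul_inv, funext fun _ => u'.inv_mul⟩, rfl⟩
  rcases le_total n m with hnm | hmn
  · -- `c·ξ^n = (c'·ξ^(m-n))·ξ^n ⇒ c = c'·ξ^(m-n) ⇒ ξ^(m-n)` is a unit
    have h1 : (fun _ : T => (u : M)) * ξ ^ n = (fun _ : T => (u' : M)) * ξ ^ (m - n) * ξ ^ n := by
      rw [h, mul_assoc, ← pow_add, Nat.sub_add_cancel hnm]
    have h2 := mul_right_cancel h1
    have h3 : IsUnit (ξ ^ (m - n)) := by
      have h4 : IsUnit ((fun _ : T => (u' : M)) * ξ ^ (m - n)) := h2 ▸ hcu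
      exact (IsUnit.mul_iff.mp h4).2
    have := exponent_eq_zero_of_isUnit_pow hξu h3
    omega
  · have h1 : (fun _ : T => (u' : M)) * ξ ^ m = (fun _ : T => (u : M)) * ξ ^ (n - m) * ξ ^ m := by
      rw [← h, mul_assoc, ← pow_add, Nat.sub_add_cancel hmn]
    have h2 := mul_right_cancel h1
    have h3 : IsUnit (ξ ^ (n - m)) := by
      have h4 : IsUnit ((fun _ : T => (u : M)) * ξ ^ (n - m)) := h2 ▸ hcu'
      exact (IsUnit.mul_iff.mp h4).2
    have := exponent_eq_zero_of_isUnit_pow hξu h3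
    omega

include hξ in
/-- **The unit part of an invariant is invariant**: if `c·ξ^n` is fixed by `β(V)`, so is `c` (cancel `ξ^n`, which is fixed
label by label). [cite: Mochizuki2012, Def 3.8 (ii) p.113] -/
theorem unitPart_mem_invariants (V : Subgroup G) (c : T → M) (n : ℕ)
    (hx : ∀ v ∈ V, piIso T (β v) (c * ξ ^ n) = c * ξ ^ n) : ∀ v ∈ V, piIso T (β v) c = c := by
  intro v hv
  have h1 : piIso T (β v) c * ξ ^ n = c * ξ ^ n := by
    have h2 := hx v hv
    rwa [map_mul, map_pow, piIso_eq_self_of_fixed (β v) (hξ v)] at h2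
  exact mul_right_cancel h1

omit [IsCancelMul M] in
/-- A unit diagonal `c = (u)_t` lies in `Ψ_ξ`. [cite: Mochizuki2012, Cor 3.5 (ii) p.94] -/
theorem unitDiagonal_le_gaussianMonoid (ξ : T → M) : unitDiagonal T M ≤ gaussianMonoid ξ := le_sup_left

omit [IsCancelMul M] in
/-- **An invariant unit diagonal is a unit OF THE MONOID `Ψ_ξ^V`**: its inverse `(u⁻¹)_t` is again a `β(V)`-fixed unit diagonal.
[cite: Mochizuki2012, Def 3.8 (ii) p.113] -/
theorem isUnit_invariants_of_mem_unitDiagonal (V : Subgroup G) (x : (gaussianCovering β ξ hS).invariants V)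
    (hc : ((x : gaussianMonoid ξ) : T → M) ∈ unitDiagonal T M) : IsUnit x := by
  obtain ⟨u, hu⟩ := hc
  -- the candidate inverse
  have hfix : ∀ v ∈ V, piIso T (β v) ((x : gaussianMonoid ξ) : T → M) = ((x : gaussianMonoid ξ) : T → M) :=
    fun v hv => congrArg (fun z : gaussianMonoid ξ => (z : T → M)) (x.2 v hv)
  have hyfix : ∀ v ∈ V, piIso T (β v) (fun _ : T => ((u⁻¹ : Mˣ) : M)) = fun _ : T => ((u⁻¹ : Mˣ) : M) := by
    intro v hv
    funext t
    have h1 : β v (u : M) = u := by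
      have := congrFun (hfix v hv) t
      rw [hu] at this
      exact this
    change β v ((u⁻¹ : Mˣ) : M) = ((u⁻¹ : Mˣ) : M)
    have h2 : Units.map (β v).toMonoidHom u = u := Units.ext h1
    calc β v ((u⁻¹ : Mˣ) : M) = ((Units.map (β v).toMonoidHom u)⁻¹ : Mˣ) := by
          rw [Units.coe_map_inv]; rfl
      _ = ((u⁻¹ : Mˣ) : M) := by rw [h2]
  let y : (gaussianCovering β ξ hS).invariants V :=
    ⟨⟨fun _ => ((u⁻¹ : Mˣ) : M), unitDiagonal_le_gaussianMonoid ξ ⟨u⁻¹, rfl⟩⟩,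
      fun v hv => Subtype.ext (hyfix v hv)⟩
  refine ⟨⟨x, y, ?_, ?_⟩, rfl⟩
  · apply Subtype.ext; apply Subtype.ext
    change ((x : gaussianMonoid ξ) : T → M) * (fun _ : T => ((u⁻¹ : Mˣ) : M)) = 1
    rw [hu]
    funext t
    exact u.mul_inv
  · apply Subtype.ext; apply Subtype.ext
    change (fun _ : T => ((u⁻¹ : Mˣ) : M)) * ((x : gaussianMonoid ξ) : T → M) = 1
    rw [hu]
    funext t
    exact u.inv_mul

omit [IsCancelMul M] in
include hξu in
/-- A unit of `Ψ_ξ^V` has exponent `0`: `c·ξ^n` a unit forces `ξ^n`, hence (for `n ≠ 0`) `ξ`, to be a unit of `∏ Ψ_{|t|}`.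
[cite: Mochizuki2012, Def 3.8 (ii) p.113] -/
theorem exponent_eq_zero_of_isUnit_invariants (V : Subgroup G) (x : (gaussianCovering β ξ hS).invariants V)
    {c : T → M} (n : ℕ) (hx : ((x : gaussianMonoid ξ) : T → M) = c * ξ ^ n) (hunit : IsUnit x) : n = 0 := by
  have h1 : IsUnit (((x : gaussianMonoid ξ) : T → M)) :=
    (hunit.map ((gaussianCovering β ξ hS).invariants V).subtype).map (gaussianMonoid ξ).subtype
  rw [hx] at h1
  exact exponent_eq_zero_of_isUnit_pow hξu (IsUnit.mul_iff.mp h1).2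

include hξ in
/-- Every element of `Ψ_ξ^V` is `c·ξ^n` with `c` an INVARIANT unit diagonal (so `c ∈ Ψ_ξ^V`).
[cite: Mochizuki2012, Def 3.8 (ii) p.113] -/
theorem exists_unitDiagonal_invariants_mul_pow (V : Subgroup G) (x : (gaussianCovering β ξ hS).invariants V) :
    ∃ (c : (gaussianCovering β ξ hS).invariants V) (n : ℕ),
      ((c : gaussianMonoid ξ) : T → M) ∈ unitDiagonal T M ∧ ((x : gaussianMonoid ξ) : T → M) = c * ξ ^ n := by
  obtain ⟨u, n, hx⟩ := (mem_gaussianMonoid_iff ξ _).mp (x : gaussianMonoid ξ).2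
  have hfix : ∀ v ∈ V, piIso T (β v) ((fun _ : T => (u : M)) * ξ ^ n) = (fun _ : T => (u : M)) * ξ ^ n := by
    intro v hv
    have := congrArg (fun z : gaussianMonoid ξ => (z : T → M)) (x.2 v hv)
    change piIso T (β v) ((x : gaussianMonoid ξ) : T → M) = ((x : gaussianMonoid ξ) : T → M) at this
    rwa [hx] at this
  have hcfix := unitPart_mem_invariants β hξ V _ n hfix
  exact ⟨⟨⟨fun _ => (u : M), unitDiagonal_le_gaussianMonoid ξ ⟨u, rfl⟩⟩, fun v hv => Subtype.ext (hcfix v hv)⟩, n,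
    ⟨u, rfl⟩, hx⟩

end Calculus

/-! ### §2. «divisor monoid `≅ ℕ` at EVERY object of `B^temp(G_v(−))⁰`» for `F_ξ(M^Θ_*)` -/

section Divisor

variable {T : Type w} {M : Type v} [CommMonoid M] [IsCancelMul M] {G : Type u} [Group G] (β : G →* MulAut M)
  {ξ : T → M} (hξ : ∀ (g : G) (t : T), β g (ξ t) = ξ t) (hξu : ¬ IsUnit ξ)
  (hS : ∀ (g : G) (y : T → M), y ∈ gaussianMonoid ξ → piIso T (β g) y ∈ gaussianMonoid ξ)

omit [IsCancelMul M] in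
include hξ in
/-- `ξ` itself is an element of `Ψ_ξ^V` for every `V` (it is fixed label by label). [cite: Mochizuki2012, Cor 3.5 (ii) p.95] -/
theorem xi_mem_invariants (V : Subgroup G) :
    (⟨ξ, Submonoid.mem_sup_right (Submonoid.mem_powers ξ)⟩ : gaussianMonoid ξ) ∈ (gaussianCovering β ξ hS).invariants V :=
  fun v _ => Subtype.ext (piIso_eq_self_of_fixed (β v) (hξ v))

include hξ hξu in
/-- **IUTchII:Def3.8(ii) «whose divisor monoid associates to EVERY object of `B^temp(G_v(−))⁰` a monoid isomorphic to `ℕ`»** —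
PROVED for `F_ξ(M^Θ_*) = Fgau β ξ hS`: at every object `G/V` the divisor monoid `Φ(G/V) = Ψ_ξ^V/(Ψ_ξ^V)^×` is `(ℕ, +)`, the class
of `c·ξ^n` (`c` a unit diagonal) going to `n`. [cite: Mochizuki2012, Def 3.8 (ii) p.113] -/
theorem exists_associates_invariants_gaussian_equiv_nat (V : Subgroup G) :
    ∃ d : Associates ((gaussianCovering β ξ hS).invariants V) ≃* Multiplicative ℕ,
      ∀ (x : (gaussianCovering β ξ hS).invariants V) (c : T → M) (n : ℕ), c ∈ unitDiagonal T M →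
        ((x : gaussianMonoid ξ) : T → M) = c * ξ ^ n → d (Associates.mk x) = Multiplicative.ofAdd n := by
  set MV := (gaussianCovering β ξ hS).invariants V with hMV
  set ξ' : MV := ⟨⟨ξ, Submonoid.mem_sup_right (Submonoid.mem_powers ξ)⟩, xi_mem_invariants β hξ hS V⟩ with hξ'
  have hξ'pow : ∀ n : ℕ, (((ξ' ^ n : MV) : gaussianMonoid ξ) : T → M) = ξ ^ n := fun n => by
    rw [hξ']; rfl
  let g : Multiplicative ℕ →* Associates MV := (Associates.mkMonoidHom).comp (powersHom _ ξ')
  have hg : ∀ n : ℕ, g (Multiplicative.ofAdd n) = Associates.mk (ξ' ^ n) := fun n => by simp [g]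
  -- the class of `c·ξ^n` is the class of `ξ^n`
  have hclass : ∀ (x : MV) (c : T → M) (n : ℕ), c ∈ unitDiagonal T M → ((x : gaussianMonoid ξ) : T → M) = c * ξ ^ n →
      Associates.mk x = Associates.mk (ξ' ^ n) := by
    intro x c n hc hx
    obtain ⟨c', m, hc', hx'⟩ := exists_unitDiagonal_invariants_mul_pow β hξ hS V x
    have hmn : m = n := gaussian_exponent_unique hξu hc' hc (hx'.symm.trans hx)
    subst hmn
    have hunit : IsUnit c' := isUnit_invariants_of_mem_unitDiagonal β hS V c' hc'
    have heq : x = c' * ξ' ^ m := by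
      apply Subtype.ext; apply Subtype.ext
      change ((x : gaussianMonoid ξ) : T → M) = ((c' : gaussianMonoid ξ) : T → M) * (((ξ' ^ m : MV) : gaussianMonoid ξ) : T → M)
      rw [hξ'pow, hx']
    rw [heq, Associates.mk_eq_mk_iff_associated]
    exact associated_unit_mul_left _ _ hunit
  have hsurj : Surjective g := by
    intro y
    obtain ⟨x, rfl⟩ := Associates.mk_surjective y
    obtain ⟨c, n, hc, hx⟩ := exists_unitDiagonal_invariants_mul_pow β hξ hS V x
    exact ⟨Multiplicative.ofAdd n, by rw [hg, hclass x _ n hc hx]⟩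
  have hinj : Injective g := by
    intro a b hab
    obtain ⟨n, rfl⟩ := Multiplicative.ofAdd.surjective a
    obtain ⟨k, rfl⟩ := Multiplicative.ofAdd.surjective b
    rw [hg, hg, Associates.mk_eq_mk_iff_associated] at hab
    obtain ⟨w, hw⟩ := hab
    -- the unit `w` has exponent 0, i.e. is a unit diagonal `c`; then `ξ^n·c = ξ^k` forces `n = k`
    obtain ⟨c, j, hc, hwc⟩ := exists_unitDiagonal_invariants_mul_pow β hξ hS V (w : MV)
    have hj : j = 0 := exponent_eq_zero_of_isUnit_invariants β hξu hS V (w : MV) j hwc (Units.isUnit w)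
    rw [hj, pow_zero, mul_one] at hwc
    have hTM : ξ ^ n * ((c : gaussianMonoid ξ) : T → M) = ξ ^ k := by
      have := congrArg (fun z : MV => ((z : gaussianMonoid ξ) : T → M)) hw
      change (((ξ' ^ n : MV) : gaussianMonoid ξ) : T → M) * (((w : MV) : gaussianMonoid ξ) : T → M) =
        (((ξ' ^ k : MV) : gaussianMonoid ξ) : T → M) at this
      rwa [hξ'pow, hξ'pow, hwc] at this
    have h1 : ((c : gaussianMonoid ξ) : T → M) * ξ ^ n = 1 * ξ ^ k := by rw [mul_comm, hTM, one_mul]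
    have := gaussian_exponent_unique hξu hc (unitDiagonal T M).one_mem h1
    rw [this]
  refine ⟨(MulEquiv.ofBijective g ⟨hinj, hsurj⟩).symm, fun x c n hc hx => ?_⟩
  rw [MulEquiv.symm_apply_eq, MulEquiv.ofBijective_apply, hg, hclass x c n hc hx]

end Divisor

/-! ### §3. [FrdI] Thm 5.2 hypotheses for `F_ξ(M^Θ_*)` -/

section Hypotheses

variable {T : Type w} {M : Type v} [CommMonoid M] [IsCancelMul M] {G : Type u} [Group G] (β : G →* MulAut M)
  {ξ : T → M} (hξ : ∀ (g : G) (t : T), β g (ξ t) = ξ t) (hξu : ¬ IsUnit ξ)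
  (hS : ∀ (g : G) (y : T → M), y ∈ gaussianMonoid ξ → piIso T (β g) y ∈ gaussianMonoid ξ)

omit [IsCancelMul M] in
/-- The underlying monoid `Ψ_ξ` of the Gaussian `G`-monoid is cancellative when `M` is. [cite: MochizukiFrdI2008, §0 p.11] -/
theorem isCancelMul_gaussianCovering_O [IsCancelMul M] : IsCancelMul (gaussianCovering β ξ hS).O :=
  Subtype.coe_injective.isCancelMul _ (fun _ _ => rfl)

include hξ hξu in
/-- The invariants monoids `Ψ_ξ^V` are pre-divisorial ([FrdI] Def 1.1 (i): integral — a cancellative submonoid; saturated — through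
`Ψ_ξ^V/(Ψ_ξ^V)^× ≅ ℕ`; of characteristic type — automatic, erratum (30)). [cite: MochizukiFrdI2008, Def. 1.1(i) p.19] -/
theorem isPreDivisorial_invariants_gaussian (V : Subgroup G) : IsPreDivisorial ((gaussianCovering β ξ hS).invariants V) := by
  haveI : IsCancelMul (gaussianCovering β ξ hS).O := isCancelMul_gaussianCovering_O β hS
  haveI : IsCancelMul ((gaussianCovering β ξ hS).invariants V) := (gaussianCovering β ξ hS).isCancelMul_invariants V
  have hint : IsIntegral ((gaussianCovering β ξ hS).invariants V) := isIntegral_iff_isCancelMul.mpr inferInstance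
  refine isPreDivisorial_of_isIntegral_of_isSaturated hint ?_
  obtain ⟨d, _⟩ := exists_associates_invariants_gaussian_equiv_nat β hξ hξu hS V
  refine isSaturated_of_dvd_of_pow_dvd_pow fun a b n hn hab => ?_
  have h1 : Associates.mk b ^ n ∣ Associates.mk a ^ n := by
    rw [← Associates.mk_pow, ← Associates.mk_pow]
    exact Associates.mk_dvd_mk.mpr hab
  have h2 : d (Associates.mk b) ^ n ∣ d (Associates.mk a) ^ n := by
    rw [← map_pow, ← map_pow]
    exact map_dvd d h1
  have h3 : d (Associates.mk b) ∣ d (Associates.mk a) := by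
    obtain ⟨c, hc⟩ := h2
    have hc' := congrArg Multiplicative.toAdd hc
    simp only [toAdd_mul, toAdd_pow, smul_eq_mul] at hc'
    have h4 : n * (d (Associates.mk b)).toAdd ≤ n * (d (Associates.mk a)).toAdd := by omega
    have h5 := Nat.le_of_mul_le_mul_left h4 hn
    refine ⟨Multiplicative.ofAdd ((d (Associates.mk a)).toAdd - (d (Associates.mk b)).toAdd), ?_⟩
    apply Multiplicative.toAdd.injective
    simp only [toAdd_mul, toAdd_ofAdd]
    omega
  have h6 : Associates.mk b ∣ Associates.mk a := by
    have := map_dvd d.symm h3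
    rwa [MulEquiv.symm_apply_apply, MulEquiv.symm_apply_apply] at this
  exact Associates.mk_dvd_mk.mp h6

include hξ hξu in
/-- The divisor monoids `Ψ_ξ^V/(Ψ_ξ^V)^×` are divisorial. [cite: MochizukiFrdI2008, Def. 1.1(i) p.19] -/
theorem isDivisorial_divisorFunctor_gaussian [TopologicalSpace G] :
    Objectwise (fun X _ => IsDivisorial X) (gaussianCovering β ξ hS).divisorFunctor := fun _ =>
  (isPreDivisorial_invariants_gaussian β hξ hξu hS _).isDivisorial_associates

include hξ hξu in
/-- **Pull-backs of `F_ξ(M^Θ_*)` are injective on divisor classes**: along `G/U' → G/V'` (`1·U' ↦ a·V'`) the pull-back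
`Ψ_ξ^{V'} → Ψ_ξ^{U'}`, `c·ξ^n ↦ (a·c)·ξ^n`, is the IDENTITY of `ℕ` in the coordinates `[c·ξ^n] ↦ n` — «monoid type `ℤ`», the
value-profile being `G`-fixed label by label. [cite: Mochizuki2012, Def 3.8 (ii) p.113] -/
theorem associatesMap_pull_injective_gaussian [TopologicalSpace G] {A B : CosetCat G} (α : B ⟶ A) :
    Injective (associatesMap ((gaussianCovering β ξ hS).pull α)) := by
  obtain ⟨dA, hdA⟩ := exists_associates_invariants_gaussian_equiv_nat β hξ hξu hS (A.sg : Subgroup G)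
  obtain ⟨dB, hdB⟩ := exists_associates_invariants_gaussian_equiv_nat β hξ hξu hS (B.sg : Subgroup G)
  have key : ∀ z, dB (associatesMap ((gaussianCovering β ξ hS).pull α) z) = dA z := by
    intro z
    obtain ⟨x, rfl⟩ := Associates.mk_surjective z
    obtain ⟨c, n, hc, hx⟩ := exists_unitDiagonal_invariants_mul_pow β hξ hS _ x
    rw [associatesMap_mk, hdA x _ n hc hx]
    refine hdB ((gaussianCovering β ξ hS).pull α x) (piIso T (β (rep α)) ((c : gaussianMonoid ξ) : T → M)) n
      (mem_of_map_piIso_eq (map_piIso_unitDiagonal (T := T) (β (rep α))) hc) ?_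
    have h1 : ((((gaussianCovering β ξ hS).pull α x : (gaussianCovering β ξ hS).O) : gaussianMonoid ξ) : T → M) =
        piIso T (β (rep α)) ((x : gaussianMonoid ξ) : T → M) := by
      rw [(gaussianCovering β ξ hS).coe_pull_eq_act α (rep_spec α)]
      rfl
    rw [h1, hx, map_mul, map_pow, piIso_eq_self_of_fixed (β (rep α)) (hξ (rep α))]
  intro z₁ z₂ h
  have := congrArg dB h
  rw [key, key] at this
  exact dA.injective this

include hξ hξu in
/-- `G/V ↦ Ψ_ξ^V` is a monoid on `CosetCat G` ([FrdI] Def 1.1 (ii); w4-d019's `isMonoidOn_invariantsFunctor_of`).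
[cite: MochizukiFrdI2008, Def. 1.1(ii) p.19] -/
theorem isMonoidOn_invariantsFunctor_gaussian [TopologicalSpace G] [IsTopologicalGroup G] :
    IsMonoidOn (gaussianCovering β ξ hS).invariantsFunctor :=
  isMonoidOn_invariantsFunctor_of _ fun α => associatesMap_pull_injective_gaussian β hξ hξu hS α

include hξ hξu in
/-- The divisor monoid `Φ` of `F_ξ(M^Θ_*)` is a monoid on `CosetCat G` ([FrdI] Def 1.1 (ii)). [cite: MochizukiFrdI2008, Def. 1.1(ii) p.19] -/
theorem isMonoidOn_divisorFunctor_gaussian [TopologicalSpace G] [IsTopologicalGroup G] :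
    IsMonoidOn (gaussianCovering β ξ hS).divisorFunctor :=
  isMonoidOn_divisorFunctor_of _ fun α => associatesMap_pull_injective_gaussian β hξ hξu hS α

include hξ hξu in
/-- **[FrdI] Thm 5.2 HYPOTHESES for `F_ξ(M^Θ_*)`** (abc-iut-L1-lead's interface condition (2) for the Gaussian Frobenioid of
[IUTchII] Def 3.8 (ii)): for a value-profile fixed label by label, a cancellative constant monoid and `ξ` a non-unit, the data
`(Φ, B) = (Ψ_ξ^{(-)}/units, (Ψ_ξ^{(-)})^gp)` of `Fgau β ξ hS` over `CosetCat G` satisfy `ModelFrobenioid.Hypotheses` — `Φ` divisorial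
monoid, `B` group-like monoid, base connected and totally epimorphic (abc-iut-L5-t2) — so «gives rise to a `p_v`-adic Frobenioid»
is an honest instance of abc-iut-L1-t2's [FrdI] Thm 5.2 model Frobenioid; by `FFgau γ e ξ hS' := Fgau γ (e⁻¹∘ξ) hS'` the same holds
verbatim for `F_{F_ξ}(†F_v)` (at the transported hypotheses, `GMonoidFrobenioidsGaussianCor37Proofs.fixed_transport`).
[cite: Mochizuki2012, Def 3.8 (ii) p.113] -/
theorem hypotheses_gaussian [TopologicalSpace G] [IsTopologicalGroup G] :
    ModelFrobenioid.Hypotheses (gaussianCovering β ξ hS).divisorFunctor (gaussianCovering β ξ hS).ratFnFunctor := by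
  haveI : IsCancelMul (gaussianCovering β ξ hS).O := isCancelMul_gaussianCovering_O β hS
  exact
    { isMonoidOn := isMonoidOn_divisorFunctor_gaussian β hξ hξu hS
      isDivisorial := isDivisorial_divisorFunctor_gaussian β hξ hξu hS
      isMonoidOn_rat := isMonoidOn_ratFnFunctor _
      isGroupLike_rat := isGroupLike_ratFnFunctor _
      isGraphConnected := isGraphConnected_cosetCat
      isTotallyEpimorphic := CosetCat.isTotallyEpimorphic }

include hξ hξu in
/-- **IUTchII:Def3.8(ii) for `F_ξ(M^Θ_*)`, assembled**: [FrdI] Thm 5.2's hypotheses AND «divisor monoid `≅ ℕ` at every object».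
[cite: Mochizuki2012, Def 3.8 (ii) p.113] -/
theorem def38ii_gaussian [TopologicalSpace G] [IsTopologicalGroup G] :
    ModelFrobenioid.Hypotheses (gaussianCovering β ξ hS).divisorFunctor (gaussianCovering β ξ hS).ratFnFunctor ∧
      ∀ V : Subgroup G, Nonempty (Associates ((gaussianCovering β ξ hS).invariants V) ≃* Multiplicative ℕ) :=
  ⟨hypotheses_gaussian β hξ hξu hS, fun V => ⟨(exists_associates_invariants_gaussian_equiv_nat β hξ hξu hS V).choose⟩⟩

end Hypotheses

end BadPrimeGaussianMonoids

end Literature.IUT.HodgeArakelov
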